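import Summits.ResolutionOfSingularities.ResolutionOfSingularities.Theorems.FrobeniusLadderFRationalResolutionChartAlgebraFixedPointDim
import Summits.ResolutionOfSingularities.ResolutionOfSingularities.Theorems.FrobeniusLadderFRationalResolutionVertexChartBlowup
import HarnessLib

/-!
# Crux `FrobeniusLadder.FRationalResolution` (stmt-ResolutionOfSingularities-15317), line `redirect`,
# stub `stub_diagonalizableQuotientResolution` — **the centre of the next blow-up: at the fixed point
# of a vertex chart algebra over a closed-stratum point the maximal ideal is `(χ(v), χ(x), χ(y))`**
# (surface case over arbitrary fields; the link between "blow up the reduced singular point" on the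
# scheme side (P7) and the three-chart log blow-up of `…VertexChartBlowup` / `…VertexChartBlowupCharts`)

For a chart algebra `C = A[χ(Q)]` over a chart `φ` at a point `𝔭` of zero-dimensional log stratum
(`𝔪_{A_𝔭} = I(𝔭, φ)A_𝔭`), `Q` a vertex chart monoid `L + {m v + l x : m ≥ 0, m + c l ≥ 0}` (`c ≥ 1`),
and `𝔓` the torus-fixed prime over `𝔭` (containing `χ(Q ∖ L)`):

* `ideal_eq_span_three` — Kato's ideal of `χ` at `𝔓` is generated by `χ(v), χ(x), χ(y)`;
* **`maximalIdeal_eq_map_span_three`** — `𝔪_{C_𝔓} = (χ(v), χ(x), χ(y))·C_𝔓`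
  (`…ChartAlgebraFixedPointDim.maximalIdeal_eq_map_ideal_of_fixedPrime` +
  `…VertexChartBlowup.span_chi_three_eq`).

So near the (singular, `…VertexChartRegularity`) fixed point the blow-up of the REDUCED point is the
blow-up along the ideal `(χ(v), χ(x), χ(y))`, whose three affine charts are the chart algebras of
`…VertexChartBlowupCharts`. Honest label: bookkeeping toward ONE leaf stub (no stub, crux or summit
closed). No definitions, no named facts, no sorry. [cite: Kato1994, Def. (2.1), (10.1)]
-/

noncomputable section

-- single-problem summit: the doubled namespace component is forced
set_option linter.dupNamespace false

open IsLocalRing Literature.AlgebraicGeometry.Resolution Literature.AlgebraicGeometry.Resolution.LogChart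
open Summit.ResolutionOfSingularities.ResolutionOfSingularities.Theorems.FRationalResolution.ChartAlgebraFixedPoint
open Summit.ResolutionOfSingularities.ResolutionOfSingularities.Theorems.FRationalResolution.ChartAlgebraFixedPointDim
open Summit.ResolutionOfSingularities.ResolutionOfSingularities.Theorems.FRationalResolution.VertexChartMonoid
open Summit.ResolutionOfSingularities.ResolutionOfSingularities.Theorems.FRationalResolution.VertexChartBlowup

namespace Summit.ResolutionOfSingularities.ResolutionOfSingularities.Theorems.FRationalResolution.VertexChartCentre

universe u

variable {A : Type u} [CommRing A] {n : ℕ} {P : AddSubmonoid (Fin n → ℤ)} {φ : Multiplicative P →* A}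
  {𝔭 : Ideal A} [𝔭.IsPrime] {C : Type u} [CommRing C] [Algebra A C] {Q : AddSubmonoid (Fin n → ℤ)}
  {χ : Multiplicative Q →* C} {v x : Fin n → ℤ} {c : ℕ} {𝔓 : Ideal C} [𝔓.IsPrime]

/-- **Kato's ideal at the fixed point is `(χ(v), χ(x), χ(y))`.** [cite: Kato1994, Def. (2.1), (10.1)] -/
theorem ideal_eq_span_three (hc : 1 ≤ c) (hPQ : P ≤ Q)
    (hχ : ∀ p : P, χ (Multiplicative.ofAdd ⟨(p : Fin n → ℤ), hPQ p.2⟩) =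
      algebraMap A C (φ (Multiplicative.ofAdd p)))
    (hQ : ∀ w, w ∈ Q ↔ ∃ g ∈ Submodule.span ℤ (faceMonoid P φ 𝔭 : Set (Fin n → ℤ)), ∃ m l : ℤ,
      0 ≤ m ∧ 0 ≤ m + (c : ℤ) * l ∧ w = g + m • v + l • x)
    (hind : ∀ g ∈ Submodule.span ℤ (faceMonoid P φ 𝔭 : Set (Fin n → ℤ)), ∀ m l : ℤ,
      g + m • v + l • x = 0 → m = 0 ∧ l = 0)
    (h𝔓 : 𝔓.comap (algebraMap A C) = 𝔭)
    (hq : ∀ q : Q, (q : Fin n → ℤ) ∉ Submodule.span ℤ (faceMonoid P φ 𝔭 : Set (Fin n → ℤ)) →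
      χ (Multiplicative.ofAdd q) ∈ 𝔓) :
    ideal Q χ 𝔓 = Ideal.span ((fun q : Q => χ (Multiplicative.ofAdd q)) ''
      {q : Q | (q : Fin n → ℤ) = v ∨ (q : Fin n → ℤ) = x ∨ (q : Fin n → ℤ) = (c : ℤ) • v - x}) := by
  have hset : {q : Q | χ (Multiplicative.ofAdd q) ∈ 𝔓} =
      {q : Q | (q : Fin n → ℤ) ∉ Submodule.span ℤ (faceMonoid P φ 𝔭 : Set (Fin n → ℤ))} := by
    ext q
    simp only [Set.mem_setOf_eq]
    rw [← not_mem_iff_mem_span_of_comap_eq hPQ hχ h𝔓 hq q, not_not]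
  unfold ideal
  rw [hset]
  exact span_chi_three_eq χ hc hQ hind

/-- **The maximal ideal at the fixed point is `(χ(v), χ(x), χ(y))·C_𝔓`** when the stratum of `𝔭` is
a point (`𝔪_{A_𝔭} ≤ I(𝔭, φ)A_𝔭`): the centre of the next round of the point-blow-up recursion, on the
chart, is the ideal generated by the three monomials. [cite: Kato1994, Def. (2.1), (10.1)] -/
theorem maximalIdeal_eq_map_span_three (hc : 1 ≤ c) (hPQ : P ≤ Q)
    (hχ : ∀ p : P, χ (Multiplicative.ofAdd ⟨(p : Fin n → ℤ), hPQ p.2⟩) =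
      algebraMap A C (φ (Multiplicative.ofAdd p)))
    (hgen : Algebra.adjoin A (Set.range χ) = ⊤)
    (hQ : ∀ w, w ∈ Q ↔ ∃ g ∈ Submodule.span ℤ (faceMonoid P φ 𝔭 : Set (Fin n → ℤ)), ∃ m l : ℤ,
      0 ≤ m ∧ 0 ≤ m + (c : ℤ) * l ∧ w = g + m • v + l • x)
    (hind : ∀ g ∈ Submodule.span ℤ (faceMonoid P φ 𝔭 : Set (Fin n → ℤ)), ∀ m l : ℤ,
      g + m • v + l • x = 0 → m = 0 ∧ l = 0)
    (h𝔓 : 𝔓.comap (algebraMap A C) = 𝔭)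
    (hq : ∀ q : Q, (q : Fin n → ℤ) ∉ Submodule.span ℤ (faceMonoid P φ 𝔭 : Set (Fin n → ℤ)) →
      χ (Multiplicative.ofAdd q) ∈ 𝔓)
    (h0 : maximalIdeal (Localization.AtPrime 𝔭) ≤
      (ideal P φ 𝔭).map (algebraMap A (Localization.AtPrime 𝔭))) :
    maximalIdeal (Localization.AtPrime 𝔓) =
      (Ideal.span ((fun q : Q => χ (Multiplicative.ofAdd q)) ''
        {q : Q | (q : Fin n → ℤ) = v ∨ (q : Fin n → ℤ) = x ∨ (q : Fin n → ℤ) = (c : ℤ) • v - x})).map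
        (algebraMap C (Localization.AtPrime 𝔓)) := by
  rw [maximalIdeal_eq_map_ideal_of_fixedPrime hPQ hχ hgen (vertex_face hc hQ hind) h𝔓 hq h0,
    ideal_eq_span_three hc hPQ hχ hQ hind h𝔓 hq]

end Summit.ResolutionOfSingularities.ResolutionOfSingularities.Theorems.FRationalResolution.VertexChartCentre

end
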